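import Mathlib
import Summits.ValiantsHypothesis.ValiantsHypothesis.Theorems.NewtonUnitEquationsNewtonTauWeakSquareRegime

/-!
# `NewtonUnitEquationsNewtonTauWeakSquareToPoly` — polynomiality of weighted level sets is decided in the square regime

Registered stub `stub_squareToPoly` of line `binomial-normal-form` (crux `NewtonTauWeak`, stmt-ValiantsHypothesis-5904,
lead c6, wave 3, STUB-PLAN Tier 1, S5 in hypothesis form).

Setting.  Items `j : Fin N` carry weights `1 ≤ g j ≤ c` and exponents `d j ∈ ℕ²`; the weight-`v` level set of subset
sums is `X_v = {Σ_{j ∈ J} d j : Σ_{j ∈ J} g j = v}` and `LV(N, g, d, v)` is the number of extreme points of its convex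
hull (after the coordinate embedding `ℕ² → ℝ²`).

Claim.  Assume the kernel bootstrap `hKB` (`LV(N, g, d, v) ≤ (4N² + 5) · B` whenever `B` bounds all level-set
vertex counts on `n ≤ 4c·c` items with weights in `[1, c]`) and the square-regime bound `hSq`
(`LV ≤ (c + 2)^e` whenever `N ≤ 4c·c`).  Then `LV(N, g, d, v) ≤ (cN + 2)^(e + 4)` for all `N`.

Proof.  For `N = 0` the level set has at most one point (`SquareRegimeAux.ncard_extremePoints_le_two_pow` with
`2^0 = 1 ≤ 2^(e+4)`).  For `N ≥ 1` the weight bounds force `1 ≤ c`; feed `hKB` with `B := (c + 2)^e`, the inner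
hypothesis being `hSq`, and finish with the arithmetic `(4N² + 5) · (c + 2)^e ≤ (cN + 2)^4 · (cN + 2)^e`
(`SquareRegimeAux.four_mul_sq_add_five_le` and `c + 2 ≤ cN + 2`).
Everything is folklore; no named facts, no citations, no `def`s.
-/

-- Sub = Summit single-conjunct layout: the duplicated namespace component is mandated by the tree.
set_option linter.dupNamespace false

noncomputable section

open scoped BigOperators

namespace Summit.ValiantsHypothesis.ValiantsHypothesis.Theorems.NewtonUnitEquationsNewtonTauWeak

/-- **Polynomiality is decided in the square regime (registered stub `stub_squareToPoly`, S5 in hypothesis form).**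
Given the kernel bootstrap `hKB : LV(N) ≤ (4N² + 5) · B` (for any `B` bounding the level-set vertex counts on
`n ≤ 4c·c` items with weights in `[1, c]`) and the square-regime bound `hSq : LV ≤ (c + 2)^e` for `N ≤ 4c·c`, every
weighted level set with weights in `[1, c]` has at most `(cN + 2)^(e + 4)` hull vertices.  `N = 0`: at most one point;
`N ≥ 1`: `hKB` with `B := (c + 2)^e` discharged by `hSq`, then `(4N² + 5)(c + 2)^e ≤ (cN + 2)^(e + 4)`. [folklore] -/
theorem stub_squareToPoly (e : ℕ)
    (hKB : ∀ (N c v B : ℕ) (g : Fin N → ℕ), (∀ j, 1 ≤ g j ∧ g j ≤ c) → ∀ d : Fin N → (Fin 2 →₀ ℕ),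
      (∀ (n v' : ℕ) (g' : Fin n → ℕ) (d' : Fin n → (Fin 2 →₀ ℕ)), n ≤ 4 * c * c →
        (∀ j, 1 ≤ g' j ∧ g' j ≤ c) →
        (Set.extremePoints ℝ (convexHull ℝ ((fun e : Fin 2 →₀ ℕ => fun i : Fin 2 => ((e i : ℕ) : ℝ)) ''
        (((Finset.univ.filter fun J : Finset (Fin n) => ∑ j ∈ J, g' j = v').image
          fun J => ∑ j ∈ J, d' j : Finset (Fin 2 →₀ ℕ)) : Set (Fin 2 →₀ ℕ))))).ncard ≤ B) →
      (Set.extremePoints ℝ (convexHull ℝ ((fun e : Fin 2 →₀ ℕ => fun i : Fin 2 => ((e i : ℕ) : ℝ)) ''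
        (((Finset.univ.filter fun J : Finset (Fin N) => ∑ j ∈ J, g j = v).image
          fun J => ∑ j ∈ J, d j : Finset (Fin 2 →₀ ℕ)) : Set (Fin 2 →₀ ℕ))))).ncard ≤ (4 * (N * N) + 5) * B)
    (hSq : ∀ (N c v : ℕ) (g : Fin N → ℕ), N ≤ 4 * c * c → (∀ j, 1 ≤ g j ∧ g j ≤ c) →
      ∀ d : Fin N → (Fin 2 →₀ ℕ),
      (Set.extremePoints ℝ (convexHull ℝ ((fun e : Fin 2 →₀ ℕ => fun i : Fin 2 => ((e i : ℕ) : ℝ)) ''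
        (((Finset.univ.filter fun J : Finset (Fin N) => ∑ j ∈ J, g j = v).image
          fun J => ∑ j ∈ J, d j : Finset (Fin 2 →₀ ℕ)) : Set (Fin 2 →₀ ℕ))))).ncard ≤ (c + 2) ^ e)
    (N c v : ℕ) (g : Fin N → ℕ) (hg : ∀ j, 1 ≤ g j ∧ g j ≤ c) (d : Fin N → (Fin 2 →₀ ℕ)) :
    (Set.extremePoints ℝ (convexHull ℝ ((fun e : Fin 2 →₀ ℕ => fun i : Fin 2 => ((e i : ℕ) : ℝ)) ''
        (((Finset.univ.filter fun J : Finset (Fin N) => ∑ j ∈ J, g j = v).image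
          fun J => ∑ j ∈ J, d j : Finset (Fin 2 →₀ ℕ)) : Set (Fin 2 →₀ ℕ))))).ncard ≤ (c * N + 2) ^ (e + 4) := by
  have hpos : 1 ≤ c * N + 2 := by omega
  rcases Nat.eq_zero_or_pos N with hN0 | hNpos
  · -- no items: the level set has at most one point
    subst hN0
    refine (SquareRegimeAux.ncard_extremePoints_le_two_pow 0 v g d).trans ?_
    rw [pow_zero]
    exact Nat.one_le_pow _ _ hpos
  have hc : 1 ≤ c := by
    have := hg ⟨0, hNpos⟩
    omega
  have hmono : (c + 2) ^ e ≤ (c * N + 2) ^ e :=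
    Nat.pow_le_pow_left (by nlinarith [Nat.le_mul_of_pos_right c hNpos]) e
  refine (hKB N c v ((c + 2) ^ e) g hg d fun n v' g' d' hn hg' => hSq n c v' g' hn hg' d').trans ?_
  rw [pow_add, mul_comm ((c * N + 2) ^ e)]
  exact Nat.mul_le_mul (SquareRegimeAux.four_mul_sq_add_five_le N c hc) hmono

end Summit.ValiantsHypothesis.ValiantsHypothesis.Theorems.NewtonUnitEquationsNewtonTauWeak

end
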